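/-
Copyright (c) 2026 the pub-hodgecm-mathlib formalisation cell (harness21).  Prover seat hodgecm-mathlib-LH7-p04 (g13): line LH7 hand on the LH4 dyadic chain (D-UNR),
brick (L2-4)-dy «LIFT-LEVI 2-FREE», FILE L5 «THE SHEARED HEISENBERG CHART AT LEVEL TWO»; 2026-09-03.
-/
import Literature.NumberTheory.Automorphic.HeisenbergLevelTwoChart              -- ★ (F0P3-p02 (g15)): §1 level-two bookkeeping (`valued_inv_mul_trichotomy`, `red_inv_mul_ne_zero_iff`, `red_eq_zero_of_v_lt_one`, `redMat_strictUpper`, `valued_levelTwo_cases`, `exp_neg_lt_one`), §2 `inv_smul_map_heisElt_sub_one`, `rank_redMat_inv_smul_map_heisElt_sub_one_eq_two` (2-free), §3 the balls `ϖ𝔪`, `ϖ𝔪⁻`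
import Literature.NumberTheory.Automorphic.TorusTwoDeepLevelTwoStrata            -- ★ (F0P3-p02 (g15)): §1 matrix algebra at level two (`valBound_strictUpper`), the `v ∤ 2` statements of §4 (pattern)
import Literature.NumberTheory.Automorphic.HeisenbergShearedStrataPreimages        -- ★ FILE L2a (this seat, p853563): the shear, `sub_invOf_two_mul_mem_skewPart`; brings ★ FILE L1 (`heisElt_mem_cmLocalIntegralLevel_iff_shear`, `rank_redMat_map_heisElt_sub_one_eq_*_of_shear`, `add_sub_invOf_two_mul_eq_heisZ_add`)
import HarnessLib

/-!
# The SHEARED Heisenberg chart at level two: the three interior rank strata of `N ∩ K₃` as sheared products, at a non-split UNRAMIFIED place of ANY residue characteristic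

Topic `NumberTheory/Automorphic`; namespace `Literature.NumberTheory.Automorphic.UnitaryGroup`.  KERNEL MATHEMATICS ONLY: theorems, no definition, no named fact, no `sorry`,
no instance, no notation.  Cell `pub/hodgecm-mathlib` (D-0151), crux H413 = `stmt-HodgeConjecture-24833`, half A line LH4 (dyadic pay-down of `stub_N6nsDyadic`, organ (D-UNR)
`stub_DyUnramCore`), brick **(L2-4)-dy «LIFT-LEVI 2-FREE»**, FILE L5 (seat LH7-p04 (g13)): the `h2w : |2|_w = 1`-FREE twin of ★ `HeisenbergLevelTwoChart` §2 (`valued_heisZ_apply_levelTwo`,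
`rank_redMat_inv_smul_map_heisElt_sub_one_eq_one ∕ _eq_zero`, `rank_redMat_map_heisElt_sub_one_eq_zero_iff`, `preimage_heisHomeomorph_levelTwoStratum_two ∕ _one ∕ _zero`) in the
SHEARED coordinate `y′ = y + (c − ½)·x·σx = z + c·x·σx` of ★ FILE L1 (`σc + c = 1`, `|c_w| ≤ 1`).  Consumers: FILE L6 (the level-two strata volumes and integral, any residue
characteristic), FILE L7 ((O2″) `classOrbitalIntegral_eq_mul_levelTwoStrata_of_torus_twoDeep` minus `h2w`), FILE L8 (`liftLevi_of_organs` minus `h2`).  HONEST LABEL: HC_CM is proved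
only modulo the 7 printed citations (2 remaining named inputs: hLiu418 = stmt-HodgeConjecture-24832, h413 = stmt-HodgeConjecture-24833) until rung 0 closes; count-neutral, discharges nothing.

THE MATHEMATICS ([Rogawski1990] §1.10 p. 9, §4.9 p. 54; [Kottwitz1986BaseChangeUnits] §1).  `L` CM, `v` NON-SPLIT and UNRAMIFIED in `L` (`|ϖ_v|_w = exp(−1)`, `q = N𝔭_v`), ANY residue
characteristic; `n = u(x, z) ∈ N`, `z = y − ½·x·σx`, `y′ = z + c·x·σx`.  For `|x_w| < 1` the perturbation `c·x·σx` has `|·|_w ≤ |x_w|² ≤ exp(−2)`, STRICTLY below the level-two shell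
`exp(−1)`: so **`|y′_w| = exp(−1) ⇒ |z_w| = exp(−1)`** and **`|y′_w| ≤ exp(−2) ⇒ |z_w| ≤ exp(−2)`** (§1, `valued_heisZ_apply_levelTwo_of_shear`) — ★'s `valued_heisZ_apply_levelTwo`
with `½ ↦ c`.  Hence the level-two matrix `ϖ⁻¹(u(x,z)_w − 1) = S(x_w/ϖ, z_w/ϖ, −(σx)_w/ϖ)` has residual rank `2` iff `|x_w| = exp(−1)` (★, 2-free), `1` iff `|x_w| ≤ exp(−2)` and
`|y′_w| = exp(−1)`, `0` iff `|x_w|, |y′_w| ≤ exp(−2)` (§2), and the three INTERIOR STRATA `{n ∈ N ∩ K₃ : rank(red(n_w) − 1) = 0, rank(red(ϖ⁻¹(n_w − 1))) = r}` have chart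
preimages **`Ψ⁻¹({|x_w| = exp(−1)} × 𝔪⁻)`, `Ψ⁻¹(ϖ𝔪 × {|y_w| = exp(−1)})`, `Ψ⁻¹(ϖ𝔪 × ϖ𝔪⁻)`** under the measure-preserving shear `Ψ(x, y) = (x, (c − ½)·x·σx + y)` of ★ FILE L2a
(§3) — ★ §2's products, sheared.  The balls `ϖ𝔪`, `ϖ𝔪⁻`, their measures and shells are ★ §3 (2-free, imported); §4 reads the interior points in the `z`-coordinate
(`ϖ⁻¹(n_w − 1)` integral with cube-nilpotent reduction — ★ `TorusTwoDeepLevelTwoStrata` §2 with `h2w` deleted).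

## References
* [Rogawski1990] J. D. Rogawski, *Automorphic Representations of Unitary Groups in Three Variables*, Ann. of Math. Stud. 123 (1990), §1.10 p. 9; §4.9 p. 54.
* [Kottwitz1986BaseChangeUnits] R. E. Kottwitz, *Base change for unit elements of Hecke algebras*, Compositio Math. 60 (1986), §1 pp. 240–241 (congruence filtration, level-`j` pieces).
* [GetzHahn2024] J. Getz, H. Hahn, *An Introduction to Automorphic Representations*, GTM 300 (2024), §3.2 Example 3.1 p. 56 (Haar measures in coordinates).
-/

set_option autoImplicit false

noncomputable section

open IsDedekindDomain NumberField Matrix MeasureTheory Measure Topology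
open scoped NumberField MatrixGroups Matrix NNReal ENNReal WithZero ValuativeRel Pointwise

namespace Literature.NumberTheory.Automorphic.UnitaryGroup

open Literature.NumberTheory.Automorphic Literature.NumberTheory.Automorphic.IntegralReduction Literature.NumberTheory.GaloisRepresentations

variable (L : Type) [Field L] [NumberField L] [IsCMField L] (v : HeightOneSpectrum (𝓞 ↥(maximalRealSubfield L)))
  (w : PlacesOver L v) (hw : IsCMField.complexConj L • w.1 = w.1)

/-! ## §1 The `z`-coordinate at level two in the sheared reading -/

include hw in
/-- **Valuation of the `z`-coordinate at level two, SHEARED**: for `|x_w| < 1` and `|c_w| ≤ 1`, `|z_w − y′_w| = |c_w·x_w·σx_w| ≤ exp(−2)` (`y′ = y + (c − ½)·x·σx = z + c·x·σx`);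
hence `|y′_w| = exp(−1) ⇒ |z_w| = exp(−1)` and `|y′_w| ≤ exp(−2) ⇒ |z_w| ≤ exp(−2)` — ★ `valued_heisZ_apply_levelTwo` with `½ ↦ c`, no `|2|_w = 1`. [cite: Rogawski1990, §1.10 p. 9] -/
theorem valued_heisZ_apply_levelTwo_of_shear [Invertible (2 : LocalRing L v)] {c : LocalRing L v} (hcw : Valued.v (c w) ≤ 1)
    {x : LocalRing L v} (hx : Valued.v (x w) < 1) (y : LocalRing L v) :
    (Valued.v ((y + (c - ⅟(2 : LocalRing L v)) * (x * conjLocal L (IsCMField.complexConj L) v x)) w) = WithZero.exp (-1 : ℤ) →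
        Valued.v ((HeisRing.heisZ (conjLocal L (IsCMField.complexConj L) v) x y) w) = WithZero.exp (-1 : ℤ)) ∧
    (Valued.v ((y + (c - ⅟(2 : LocalRing L v)) * (x * conjLocal L (IsCMField.complexConj L) v x)) w) ≤ WithZero.exp (-2 : ℤ) →
        Valued.v ((HeisRing.heisZ (conjLocal L (IsCMField.complexConj L) v) x y) w) ≤ WithZero.exp (-2 : ℤ)) := by
  have hz : (HeisRing.heisZ (conjLocal L (IsCMField.complexConj L) v) x y) w =
      (y + (c - ⅟(2 : LocalRing L v)) * (x * conjLocal L (IsCMField.complexConj L) v x)) w - c w * (x w * (conjLocal L (IsCMField.complexConj L) v x) w) := by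
    rw [HeisRing.add_sub_invOf_two_mul_eq_heisZ_add (conjLocal L (IsCMField.complexConj L) v) c x y, Pi.add_apply, Pi.mul_apply, Pi.mul_apply, add_sub_cancel_right]
  have hx2 : Valued.v (x w) ≤ WithZero.exp (-1 : ℤ) := (valued_lt_one_iff_le_exp_neg_one L v w _).1 hx
  have hd : Valued.v (c w * (x w * (conjLocal L (IsCMField.complexConj L) v x) w)) ≤ WithZero.exp (-2 : ℤ) := by
    rw [map_mul, map_mul, valued_conjLocal_apply_of_smul_eq L v w hw, show (-2 : ℤ) = -1 + -1 by norm_num, WithZero.exp_add]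
    calc Valued.v (c w) * (Valued.v (x w) * Valued.v (x w)) ≤ 1 * (WithZero.exp (-1 : ℤ) * WithZero.exp (-1 : ℤ)) := mul_le_mul' hcw (mul_le_mul' hx2 hx2)
      _ = WithZero.exp (-1 : ℤ) * WithZero.exp (-1 : ℤ) := one_mul _
  refine ⟨fun hy => ?_, fun hy => ?_⟩
  · rw [hz]
    have hlt : Valued.v (c w * (x w * (conjLocal L (IsCMField.complexConj L) v x) w)) <
        Valued.v ((y + (c - ⅟(2 : LocalRing L v)) * (x * conjLocal L (IsCMField.complexConj L) v x)) w) := by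
      refine lt_of_le_of_lt hd ?_
      rw [hy, WithZero.exp_lt_exp]; norm_num
    rw [Valuation.map_sub_eq_of_lt_left _ hlt, hy]
  · rw [hz]
    exact le_trans (Valuation.map_sub _ _ _) (max_le hy hd)

/-! ## §2 The three interior ranks in the sheared reading -/

include hw in
/-- **INTERIOR RANK 1, SHEARED**: `|x_w| ≤ exp(−2)`, `|y′_w| = exp(−1)` ⇒ `rank(red(ϖ⁻¹(u(x,z)_w − 1))) = 1` (any residue characteristic; ★ `…_eq_one` with `h2w` traded for `|c_w| ≤ 1`).
[cite: Rogawski1990, §4.9 p. 54] [cite: Kottwitz1986BaseChangeUnits, §1 pp. 240–241] -/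
theorem rank_redMat_inv_smul_map_heisElt_sub_one_eq_one_of_shear [Invertible (2 : LocalRing L v)] (hunr : Algebra.IsUnramifiedIn (𝓞 L) v.asIdeal)
    {c : LocalRing L v} (hcw : Valued.v (c w) ≤ 1)
    {x : LocalRing L v} {y : HeisRing.skewPart (conjLocal L (IsCMField.complexConj L) v)} (hx : Valued.v (x w) ≤ WithZero.exp (-2 : ℤ))
    (hy : Valued.v (((y : LocalRing L v) + (c - ⅟(2 : LocalRing L v)) * (x * conjLocal L (IsCMField.complexConj L) v x)) w) = WithZero.exp (-1 : ℤ)) :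
    (redMat ((toPlace v w (HeckeCharacter.uniformizer ↥(maximalRealSubfield L) v : v.adicCompletion ↥(maximalRealSubfield L)))⁻¹ • ((((HeisRing.heisElt (conjLocal L (IsCMField.complexConj L) v) (conjLocal_conjLocal_cm L v) (cmLocalForm_eq_over L 3 v) x y :
          ↥(unitaryGroupOfForm (conjLocal L (IsCMField.complexConj L) v) (cmLocalForm L 3 v))) : GL (Fin 3) (LocalRing L v)).val.map
          (Pi.evalRingHom (fun w' : PlacesOver L v => w'.1.adicCompletion L) w)) - 1))).rank = 1 := by
  obtain ⟨-, -, h3⟩ := valued_inv_mul_trichotomy L v w hunr (x w)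
  obtain ⟨-, -, h3σ⟩ := valued_inv_mul_trichotomy L v w hunr (-((conjLocal L (IsCMField.complexConj L) v x) w))
  have hx1 : Valued.v (x w) < 1 := lt_of_le_of_lt hx (by rw [← WithZero.exp_zero, WithZero.exp_lt_exp]; norm_num)
  have hσ : Valued.v (-((conjLocal L (IsCMField.complexConj L) v x) w)) ≤ WithZero.exp (-2 : ℤ) := by
    rw [Valuation.map_neg, valued_conjLocal_apply_of_smul_eq L v w hw]; exact hx
  have hz := (valued_heisZ_apply_levelTwo_of_shear L v w hw hcw hx1 (y : LocalRing L v)).1 hy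
  have hz1 : Valued.v ((HeisRing.heisZ (conjLocal L (IsCMField.complexConj L) v) x (y : LocalRing L v)) w) < 1 := by
    rw [valued_lt_one_iff_le_exp_neg_one L v w, hz]
  rw [inv_smul_map_heisElt_sub_one L v w, redMat_strictUpper, red_eq_zero_of_v_lt_one L v w (h3.2 hx), red_eq_zero_of_v_lt_one L v w (h3σ.2 hσ)]
  exact rank_strictUpper_eq_one ((red_inv_mul_ne_zero_iff L v w hunr hz1).2 hz)

include hw in
/-- **INTERIOR RANK 0, SHEARED**: `|x_w|, |y′_w| ≤ exp(−2)` ⇒ `rank(red(ϖ⁻¹(u(x,z)_w − 1))) = 0` (`u(x,z)_w ≡ 1 (ϖ²)`; any residue characteristic).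
[cite: Rogawski1990, §4.9 p. 54] [cite: Kottwitz1986BaseChangeUnits, §1 pp. 240–241] -/
theorem rank_redMat_inv_smul_map_heisElt_sub_one_eq_zero_of_shear [Invertible (2 : LocalRing L v)] (hunr : Algebra.IsUnramifiedIn (𝓞 L) v.asIdeal)
    {c : LocalRing L v} (hcw : Valued.v (c w) ≤ 1)
    {x : LocalRing L v} {y : HeisRing.skewPart (conjLocal L (IsCMField.complexConj L) v)} (hx : Valued.v (x w) ≤ WithZero.exp (-2 : ℤ))
    (hy : Valued.v (((y : LocalRing L v) + (c - ⅟(2 : LocalRing L v)) * (x * conjLocal L (IsCMField.complexConj L) v x)) w) ≤ WithZero.exp (-2 : ℤ)) :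
    (redMat ((toPlace v w (HeckeCharacter.uniformizer ↥(maximalRealSubfield L) v : v.adicCompletion ↥(maximalRealSubfield L)))⁻¹ • ((((HeisRing.heisElt (conjLocal L (IsCMField.complexConj L) v) (conjLocal_conjLocal_cm L v) (cmLocalForm_eq_over L 3 v) x y :
          ↥(unitaryGroupOfForm (conjLocal L (IsCMField.complexConj L) v) (cmLocalForm L 3 v))) : GL (Fin 3) (LocalRing L v)).val.map
          (Pi.evalRingHom (fun w' : PlacesOver L v => w'.1.adicCompletion L) w)) - 1))).rank = 0 := by
  obtain ⟨-, -, h3⟩ := valued_inv_mul_trichotomy L v w hunr (x w)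
  obtain ⟨-, -, h3σ⟩ := valued_inv_mul_trichotomy L v w hunr (-((conjLocal L (IsCMField.complexConj L) v x) w))
  obtain ⟨-, -, h3z⟩ := valued_inv_mul_trichotomy L v w hunr ((HeisRing.heisZ (conjLocal L (IsCMField.complexConj L) v) x (y : LocalRing L v)) w)
  have hx1 : Valued.v (x w) < 1 := lt_of_le_of_lt hx (by rw [← WithZero.exp_zero, WithZero.exp_lt_exp]; norm_num)
  have hσ : Valued.v (-((conjLocal L (IsCMField.complexConj L) v x) w)) ≤ WithZero.exp (-2 : ℤ) := by
    rw [Valuation.map_neg, valued_conjLocal_apply_of_smul_eq L v w hw]; exact hx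
  have hz := (valued_heisZ_apply_levelTwo_of_shear L v w hw hcw hx1 (y : LocalRing L v)).2 hy
  rw [inv_smul_map_heisElt_sub_one L v w, redMat_strictUpper, red_eq_zero_of_v_lt_one L v w (h3.2 hx), red_eq_zero_of_v_lt_one L v w (h3σ.2 hσ),
    red_eq_zero_of_v_lt_one L v w (h3z.2 hz)]
  exact rank_strictUpper_eq_zero

include hw in
/-- **In the sheared chart, `rank(red(u(x,z)_w) − 1) = 0 ⟺ |x_w| < 1 ∧ |y′_w| < 1`** for `|x_w|, |y′_w| ≤ 1` (★ FILE L1's trichotomy; any residue characteristic). [cite: Rogawski1990, §4.9 p. 54] -/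
theorem rank_redMat_map_heisElt_sub_one_eq_zero_iff_of_shear [Invertible (2 : LocalRing L v)] {c : LocalRing L v} (hcw : Valued.v (c w) ≤ 1)
    {x : LocalRing L v} {y : HeisRing.skewPart (conjLocal L (IsCMField.complexConj L) v)} (hx : Valued.v (x w) ≤ 1)
    (hy : Valued.v (((y : LocalRing L v) + (c - ⅟(2 : LocalRing L v)) * (x * conjLocal L (IsCMField.complexConj L) v x)) w) ≤ 1) :
    (redMat (((HeisRing.heisElt (conjLocal L (IsCMField.complexConj L) v) (conjLocal_conjLocal_cm L v) (cmLocalForm_eq_over L 3 v) x y :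
        ↥(unitaryGroupOfForm (conjLocal L (IsCMField.complexConj L) v) (cmLocalForm L 3 v))) : GL (Fin 3) (LocalRing L v)).val.map
        (Pi.evalRingHom (fun w' : PlacesOver L v => w'.1.adicCompletion L) w)) - 1).rank = 0 ↔
      Valued.v (x w) < 1 ∧ Valued.v (((y : LocalRing L v) + (c - ⅟(2 : LocalRing L v)) * (x * conjLocal L (IsCMField.complexConj L) v x)) w) < 1 := by
  constructor
  · intro hr
    rcases hx.lt_or_eq with hx' | hx'
    · rcases hy.lt_or_eq with hy' | hy'
      · exact ⟨hx', hy'⟩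
      · rw [rank_redMat_map_heisElt_sub_one_eq_one_of_shear L v w hw hcw hx' hy'] at hr; exact absurd hr (by decide)
    · rw [rank_redMat_map_heisElt_sub_one_eq_two L v w hw hx' y] at hr; exact absurd hr (by decide)
  · rintro ⟨hx', hy'⟩
    exact rank_redMat_map_heisElt_sub_one_eq_zero_of_shear L v w hw hcw hx' hy'

/-! ## §3 The interior strata of `N ∩ K₃` are SHEARED products in the chart -/

include hw in
/-- **INTERIOR STRATUM 2 = `Ψ⁻¹({|x_w| = |ϖ|} × 𝔪⁻)`**: `chart⁻¹ {n ∈ K₃ : rank(red(n_w) − 1) = 0, rank(red(ϖ⁻¹(n_w − 1))) = 2} = Ψ⁻¹({|x_w| = exp(−1)} × {|y_w| < 1})`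
(any residue characteristic; ★ `preimage_heisHomeomorph_levelTwoStratum_two` sheared). [cite: Rogawski1990, §4.9 p. 54] [cite: Kottwitz1986BaseChangeUnits, §1 pp. 240–241] -/
theorem preimage_heisHomeomorph_levelTwoStratum_two_eq_shear [Invertible (2 : LocalRing L v)] (hunr : Algebra.IsUnramifiedIn (𝓞 L) v.asIdeal)
    {c : LocalRing L v} (hc : conjLocal L (IsCMField.complexConj L) v c + c = 1) (hcw : Valued.v (c w) ≤ 1) :
    (HeisRing.heisHomeomorph (conjLocal L (IsCMField.complexConj L) v) (conjLocal_conjLocal_cm L v) (continuous_conjLocal L (IsCMField.complexConj L) v)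
        (cmLocalForm_eq_over L 3 v)) ⁻¹'
        {n | (n : ↥(unitaryGroupOfForm (conjLocal L (IsCMField.complexConj L) v) (cmLocalForm L 3 v))) ∈ cmLocalIntegralLevel L 3 (Matrix.of fun i j : Fin 3 => if i.val + j.val + 1 = 3 then (1 : L) else 0) v ∧
          (redMat (((n : ↥(unitaryGroupOfForm (conjLocal L (IsCMField.complexConj L) v) (cmLocalForm L 3 v))) : GL (Fin 3) (LocalRing L v)).val.map (Pi.evalRingHom (fun w' : PlacesOver L v => w'.1.adicCompletion L) w)) - 1).rank = 0 ∧
          (redMat ((toPlace v w (HeckeCharacter.uniformizer ↥(maximalRealSubfield L) v : v.adicCompletion ↥(maximalRealSubfield L)))⁻¹ • ((((n : ↥(unitaryGroupOfForm (conjLocal L (IsCMField.complexConj L) v) (cmLocalForm L 3 v))) : GL (Fin 3) (LocalRing L v)).val.map (Pi.evalRingHom (fun w' : PlacesOver L v => w'.1.adicCompletion L) w)) - 1))).rank = 2} =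
      (fun p : LocalRing L v × ↥(HeisRing.skewPart (conjLocal L (IsCMField.complexConj L) v)) =>
        (p.1, (⟨(c - ⅟(2 : LocalRing L v)) * (p.1 * conjLocal L (IsCMField.complexConj L) v p.1), sub_invOf_two_mul_mem_skewPart L v hc p.1⟩ :
          ↥(HeisRing.skewPart (conjLocal L (IsCMField.complexConj L) v))) + p.2)) ⁻¹'
        ({x : LocalRing L v | Valued.v (x w) = WithZero.exp (-1 : ℤ)} ×ˢ {y : HeisRing.skewPart (conjLocal L (IsCMField.complexConj L) v) | Valued.v ((y : LocalRing L v) w) < 1}) := by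
  obtain ⟨he1, he2, he21⟩ := exp_neg_lt_one
  ext ⟨x, y⟩
  simp only [Set.mem_preimage, Set.mem_setOf_eq, HeisRing.heisHomeomorph_apply, Set.mem_prod, AddSubgroup.coe_add]
  rw [add_comm _ ((y : LocalRing L v))]
  constructor
  · rintro ⟨hmem, hr0, hr2⟩
    obtain ⟨hx, hy⟩ := (heisElt_mem_cmLocalIntegralLevel_iff_shear L v w hw hcw x y).1 hmem
    obtain ⟨hx', hy'⟩ := (rank_redMat_map_heisElt_sub_one_eq_zero_iff_of_shear L v w hw hcw hx hy).1 hr0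
    refine ⟨?_, hy'⟩
    rcases valued_levelTwo_cases L v w hx' with hx2 | hx2
    · exact hx2
    · rcases valued_levelTwo_cases L v w hy' with hy2 | hy2
      · rw [rank_redMat_inv_smul_map_heisElt_sub_one_eq_one_of_shear L v w hw hunr hcw hx2 hy2] at hr2; exact absurd hr2 (by decide)
      · rw [rank_redMat_inv_smul_map_heisElt_sub_one_eq_zero_of_shear L v w hw hunr hcw hx2 hy2] at hr2; exact absurd hr2 (by decide)
  · rintro ⟨hx, hy⟩
    have hx' : Valued.v (x w) < 1 := by rw [hx]; exact he1
    exact ⟨(heisElt_mem_cmLocalIntegralLevel_iff_shear L v w hw hcw x y).2 ⟨hx'.le, hy.le⟩,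
      (rank_redMat_map_heisElt_sub_one_eq_zero_iff_of_shear L v w hw hcw hx'.le hy.le).2 ⟨hx', hy⟩,
      rank_redMat_inv_smul_map_heisElt_sub_one_eq_two L v w hw hunr hx y⟩

include hw in
/-- **INTERIOR STRATUM 1 = `Ψ⁻¹(ϖ𝔪 × (𝔪⁻ ∖ ϖ𝔪⁻))`**: `chart⁻¹ {… rank(red(ϖ⁻¹(n_w − 1))) = 1} = Ψ⁻¹({|x_w| ≤ exp(−2)} × {|y_w| = exp(−1)})` (any residue characteristic).
[cite: Rogawski1990, §4.9 p. 54] [cite: Kottwitz1986BaseChangeUnits, §1 pp. 240–241] -/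
theorem preimage_heisHomeomorph_levelTwoStratum_one_eq_shear [Invertible (2 : LocalRing L v)] (hunr : Algebra.IsUnramifiedIn (𝓞 L) v.asIdeal)
    {c : LocalRing L v} (hc : conjLocal L (IsCMField.complexConj L) v c + c = 1) (hcw : Valued.v (c w) ≤ 1) :
    (HeisRing.heisHomeomorph (conjLocal L (IsCMField.complexConj L) v) (conjLocal_conjLocal_cm L v) (continuous_conjLocal L (IsCMField.complexConj L) v)
        (cmLocalForm_eq_over L 3 v)) ⁻¹'
        {n | (n : ↥(unitaryGroupOfForm (conjLocal L (IsCMField.complexConj L) v) (cmLocalForm L 3 v))) ∈ cmLocalIntegralLevel L 3 (Matrix.of fun i j : Fin 3 => if i.val + j.val + 1 = 3 then (1 : L) else 0) v ∧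
          (redMat (((n : ↥(unitaryGroupOfForm (conjLocal L (IsCMField.complexConj L) v) (cmLocalForm L 3 v))) : GL (Fin 3) (LocalRing L v)).val.map (Pi.evalRingHom (fun w' : PlacesOver L v => w'.1.adicCompletion L) w)) - 1).rank = 0 ∧
          (redMat ((toPlace v w (HeckeCharacter.uniformizer ↥(maximalRealSubfield L) v : v.adicCompletion ↥(maximalRealSubfield L)))⁻¹ • ((((n : ↥(unitaryGroupOfForm (conjLocal L (IsCMField.complexConj L) v) (cmLocalForm L 3 v))) : GL (Fin 3) (LocalRing L v)).val.map (Pi.evalRingHom (fun w' : PlacesOver L v => w'.1.adicCompletion L) w)) - 1))).rank = 1} =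
      (fun p : LocalRing L v × ↥(HeisRing.skewPart (conjLocal L (IsCMField.complexConj L) v)) =>
        (p.1, (⟨(c - ⅟(2 : LocalRing L v)) * (p.1 * conjLocal L (IsCMField.complexConj L) v p.1), sub_invOf_two_mul_mem_skewPart L v hc p.1⟩ :
          ↥(HeisRing.skewPart (conjLocal L (IsCMField.complexConj L) v))) + p.2)) ⁻¹'
        ({x : LocalRing L v | Valued.v (x w) ≤ WithZero.exp (-2 : ℤ)} ×ˢ {y : HeisRing.skewPart (conjLocal L (IsCMField.complexConj L) v) | Valued.v ((y : LocalRing L v) w) = WithZero.exp (-1 : ℤ)}) := by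
  obtain ⟨he1, he2, he21⟩ := exp_neg_lt_one
  ext ⟨x, y⟩
  simp only [Set.mem_preimage, Set.mem_setOf_eq, HeisRing.heisHomeomorph_apply, Set.mem_prod, AddSubgroup.coe_add]
  rw [add_comm _ ((y : LocalRing L v))]
  constructor
  · rintro ⟨hmem, hr0, hr2⟩
    obtain ⟨hx, hy⟩ := (heisElt_mem_cmLocalIntegralLevel_iff_shear L v w hw hcw x y).1 hmem
    obtain ⟨hx', hy'⟩ := (rank_redMat_map_heisElt_sub_one_eq_zero_iff_of_shear L v w hw hcw hx hy).1 hr0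
    rcases valued_levelTwo_cases L v w hx' with hx2 | hx2
    · rw [rank_redMat_inv_smul_map_heisElt_sub_one_eq_two L v w hw hunr hx2 y] at hr2; exact absurd hr2 (by decide)
    · refine ⟨hx2, ?_⟩
      rcases valued_levelTwo_cases L v w hy' with hy2 | hy2
      · exact hy2
      · rw [rank_redMat_inv_smul_map_heisElt_sub_one_eq_zero_of_shear L v w hw hunr hcw hx2 hy2] at hr2; exact absurd hr2 (by decide)
  · rintro ⟨hx, hy⟩
    have hx' : Valued.v (x w) < 1 := lt_of_le_of_lt hx he2
    have hy' : Valued.v (((y : LocalRing L v) + (c - ⅟(2 : LocalRing L v)) * (x * conjLocal L (IsCMField.complexConj L) v x)) w) < 1 := by rw [hy]; exact he1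
    exact ⟨(heisElt_mem_cmLocalIntegralLevel_iff_shear L v w hw hcw x y).2 ⟨hx'.le, hy'.le⟩,
      (rank_redMat_map_heisElt_sub_one_eq_zero_iff_of_shear L v w hw hcw hx'.le hy'.le).2 ⟨hx', hy'⟩,
      rank_redMat_inv_smul_map_heisElt_sub_one_eq_one_of_shear L v w hw hunr hcw hx hy⟩

include hw in
/-- **INTERIOR STRATUM 0 = `Ψ⁻¹(ϖ𝔪 × ϖ𝔪⁻)`**: `chart⁻¹ {… rank(red(ϖ⁻¹(n_w − 1))) = 0} = Ψ⁻¹({|x_w| ≤ exp(−2)} × {|y_w| ≤ exp(−2)})` (any residue characteristic).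
[cite: Rogawski1990, §4.9 p. 54] [cite: Kottwitz1986BaseChangeUnits, §1 pp. 240–241] -/
theorem preimage_heisHomeomorph_levelTwoStratum_zero_eq_shear [Invertible (2 : LocalRing L v)] (hunr : Algebra.IsUnramifiedIn (𝓞 L) v.asIdeal)
    {c : LocalRing L v} (hc : conjLocal L (IsCMField.complexConj L) v c + c = 1) (hcw : Valued.v (c w) ≤ 1) :
    (HeisRing.heisHomeomorph (conjLocal L (IsCMField.complexConj L) v) (conjLocal_conjLocal_cm L v) (continuous_conjLocal L (IsCMField.complexConj L) v)
        (cmLocalForm_eq_over L 3 v)) ⁻¹'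
        {n | (n : ↥(unitaryGroupOfForm (conjLocal L (IsCMField.complexConj L) v) (cmLocalForm L 3 v))) ∈ cmLocalIntegralLevel L 3 (Matrix.of fun i j : Fin 3 => if i.val + j.val + 1 = 3 then (1 : L) else 0) v ∧
          (redMat (((n : ↥(unitaryGroupOfForm (conjLocal L (IsCMField.complexConj L) v) (cmLocalForm L 3 v))) : GL (Fin 3) (LocalRing L v)).val.map (Pi.evalRingHom (fun w' : PlacesOver L v => w'.1.adicCompletion L) w)) - 1).rank = 0 ∧
          (redMat ((toPlace v w (HeckeCharacter.uniformizer ↥(maximalRealSubfield L) v : v.adicCompletion ↥(maximalRealSubfield L)))⁻¹ • ((((n : ↥(unitaryGroupOfForm (conjLocal L (IsCMField.complexConj L) v) (cmLocalForm L 3 v))) : GL (Fin 3) (LocalRing L v)).val.map (Pi.evalRingHom (fun w' : PlacesOver L v => w'.1.adicCompletion L) w)) - 1))).rank = 0} =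
      (fun p : LocalRing L v × ↥(HeisRing.skewPart (conjLocal L (IsCMField.complexConj L) v)) =>
        (p.1, (⟨(c - ⅟(2 : LocalRing L v)) * (p.1 * conjLocal L (IsCMField.complexConj L) v p.1), sub_invOf_two_mul_mem_skewPart L v hc p.1⟩ :
          ↥(HeisRing.skewPart (conjLocal L (IsCMField.complexConj L) v))) + p.2)) ⁻¹'
        ({x : LocalRing L v | Valued.v (x w) ≤ WithZero.exp (-2 : ℤ)} ×ˢ {y : HeisRing.skewPart (conjLocal L (IsCMField.complexConj L) v) | Valued.v ((y : LocalRing L v) w) ≤ WithZero.exp (-2 : ℤ)}) := by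
  obtain ⟨he1, he2, he21⟩ := exp_neg_lt_one
  ext ⟨x, y⟩
  simp only [Set.mem_preimage, Set.mem_setOf_eq, HeisRing.heisHomeomorph_apply, Set.mem_prod, AddSubgroup.coe_add]
  rw [add_comm _ ((y : LocalRing L v))]
  constructor
  · rintro ⟨hmem, hr0, hr2⟩
    obtain ⟨hx, hy⟩ := (heisElt_mem_cmLocalIntegralLevel_iff_shear L v w hw hcw x y).1 hmem
    obtain ⟨hx', hy'⟩ := (rank_redMat_map_heisElt_sub_one_eq_zero_iff_of_shear L v w hw hcw hx hy).1 hr0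
    rcases valued_levelTwo_cases L v w hx' with hx2 | hx2
    · rw [rank_redMat_inv_smul_map_heisElt_sub_one_eq_two L v w hw hunr hx2 y] at hr2; exact absurd hr2 (by decide)
    · refine ⟨hx2, ?_⟩
      rcases valued_levelTwo_cases L v w hy' with hy2 | hy2
      · rw [rank_redMat_inv_smul_map_heisElt_sub_one_eq_one_of_shear L v w hw hunr hcw hx2 hy2] at hr2; exact absurd hr2 (by decide)
      · exact hy2
  · rintro ⟨hx, hy⟩
    have hx' : Valued.v (x w) < 1 := lt_of_le_of_lt hx he2
    have hy' : Valued.v (((y : LocalRing L v) + (c - ⅟(2 : LocalRing L v)) * (x * conjLocal L (IsCMField.complexConj L) v x)) w) < 1 := lt_of_le_of_lt hy he2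
    exact ⟨(heisElt_mem_cmLocalIntegralLevel_iff_shear L v w hw hcw x y).2 ⟨hx'.le, hy'.le⟩,
      (rank_redMat_map_heisElt_sub_one_eq_zero_iff_of_shear L v w hw hcw hx'.le hy'.le).2 ⟨hx', hy'⟩,
      rank_redMat_inv_smul_map_heisElt_sub_one_eq_zero_of_shear L v w hw hunr hcw hx hy⟩


/-! ## §4 The interior points of `N ∩ K₃` in the `z`-reading: `ϖ⁻¹(n_w − 1)` is integral with cube-nilpotent reduction (any residue characteristic) -/

include hw in
/-- **In the chart, `rank(red(u(x,z)_w) − 1) = 0 ⟺ |x_w| < 1 ∧ |z_w| < 1`** for `|x_w|, |z_w| ≤ 1` — the `z`-READING of ★ `rank_redMat_map_heisElt_sub_one_eq_zero_iff`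
(any residue characteristic; ★ FILE L1's `_of_heisZ` strata + ★ FILE A's rank-two stratum). [cite: Rogawski1990, §4.9 p. 54] -/
theorem rank_redMat_map_heisElt_sub_one_eq_zero_iff_of_heisZ [Invertible (2 : LocalRing L v)]
    {x : LocalRing L v} {y : HeisRing.skewPart (conjLocal L (IsCMField.complexConj L) v)} (hx : Valued.v (x w) ≤ 1)
    (hz : Valued.v ((HeisRing.heisZ (conjLocal L (IsCMField.complexConj L) v) x (y : LocalRing L v)) w) ≤ 1) :
    (redMat (((HeisRing.heisElt (conjLocal L (IsCMField.complexConj L) v) (conjLocal_conjLocal_cm L v) (cmLocalForm_eq_over L 3 v) x y :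
        ↥(unitaryGroupOfForm (conjLocal L (IsCMField.complexConj L) v) (cmLocalForm L 3 v))) : GL (Fin 3) (LocalRing L v)).val.map
        (Pi.evalRingHom (fun w' : PlacesOver L v => w'.1.adicCompletion L) w)) - 1).rank = 0 ↔
      Valued.v (x w) < 1 ∧ Valued.v ((HeisRing.heisZ (conjLocal L (IsCMField.complexConj L) v) x (y : LocalRing L v)) w) < 1 := by
  constructor
  · intro hr
    rcases hx.lt_or_eq with hx' | hx'
    · rcases hz.lt_or_eq with hz' | hz'
      · exact ⟨hx', hz'⟩
      · rw [rank_redMat_map_heisElt_sub_one_eq_one_of_heisZ L v w hw hx' hz'] at hr; exact absurd hr (by decide)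
    · rw [rank_redMat_map_heisElt_sub_one_eq_two L v w hw hx' y] at hr; exact absurd hr (by decide)
  · rintro ⟨hx', hz'⟩
    exact rank_redMat_map_heisElt_sub_one_eq_zero_of_heisZ L v w hw hx' hz'

include hw in
/-- **In the chart, for `|x_w|, |z_w| < 1`: `ϖ⁻¹(u(x,z)_w − 1)` is INTEGRAL and its reduction is CUBE-NILPOTENT** — the `z`-READING of ★ `valBound_inv_smul_map_heisElt_sub_one`
(no `|2|_w = 1`: the hypothesis is on `z` itself). [cite: Rogawski1990, §1.10 p. 9; §4.9 p. 54] [cite: Kottwitz1986BaseChangeUnits, §1 pp. 240–241] -/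
theorem valBound_inv_smul_map_heisElt_sub_one_of_heisZ [Invertible (2 : LocalRing L v)] (hunr : Algebra.IsUnramifiedIn (𝓞 L) v.asIdeal)
    {x : LocalRing L v} {y : HeisRing.skewPart (conjLocal L (IsCMField.complexConj L) v)} (hx : Valued.v (x w) < 1)
    (hz : Valued.v ((HeisRing.heisZ (conjLocal L (IsCMField.complexConj L) v) x (y : LocalRing L v)) w) < 1) :
    ValBound 1 ((toPlace v w (HeckeCharacter.uniformizer ↥(maximalRealSubfield L) v : v.adicCompletion ↥(maximalRealSubfield L)))⁻¹ • ((((HeisRing.heisElt (conjLocal L (IsCMField.complexConj L) v) (conjLocal_conjLocal_cm L v) (cmLocalForm_eq_over L 3 v) x y : ↥(unitaryGroupOfForm (conjLocal L (IsCMField.complexConj L) v) (cmLocalForm L 3 v))) : GL (Fin 3) (LocalRing L v)).val.map (Pi.evalRingHom (fun w' : PlacesOver L v => w'.1.adicCompletion L) w)) - 1)) ∧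
      (redMat ((toPlace v w (HeckeCharacter.uniformizer ↥(maximalRealSubfield L) v : v.adicCompletion ↥(maximalRealSubfield L)))⁻¹ • ((((HeisRing.heisElt (conjLocal L (IsCMField.complexConj L) v) (conjLocal_conjLocal_cm L v) (cmLocalForm_eq_over L 3 v) x y : ↥(unitaryGroupOfForm (conjLocal L (IsCMField.complexConj L) v) (cmLocalForm L 3 v))) : GL (Fin 3) (LocalRing L v)).val.map (Pi.evalRingHom (fun w' : PlacesOver L v => w'.1.adicCompletion L) w)) - 1))) ^ 3 = 0 := by
  have h1 := fun z => (valued_inv_mul_trichotomy L v w hunr z).1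
  have hσx : Valued.v (-((conjLocal L (IsCMField.complexConj L) v x) w)) < 1 := by
    rw [Valuation.map_neg, valued_conjLocal_apply_of_smul_eq L v w hw]; exact hx
  rw [inv_smul_map_heisElt_sub_one L v w]
  exact ⟨valBound_strictUpper L w ((h1 _).2 hx) ((h1 _).2 hz) ((h1 _).2 hσx), by rw [redMat_strictUpper, strictUpper_pow_three]⟩

include hw in
/-- **AN INTERIOR POINT OF `N ∩ K₃`, ANY RESIDUE CHARACTERISTIC** (`n ∈ K₃`, `rank(red(n_w) − 1) = 0`): `n_w` and `ϖ⁻¹(n_w − 1)` are integral and `red(ϖ⁻¹(n_w − 1))³ = 0`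
(★ `valBound_inv_smul_map_sub_one_of_rank_eq_zero` with `h2w` DELETED, read in the chart through the `z`-reading). [cite: Rogawski1990, §4.9 p. 54] [cite: Kottwitz1986BaseChangeUnits, §1 pp. 240–241] -/
theorem valBound_inv_smul_map_sub_one_of_rank_eq_zero_anyChar (hunr : Algebra.IsUnramifiedIn (𝓞 L) v.asIdeal)
    (n : ↥(unipotentU (conjLocal L (IsCMField.complexConj L) v) (cmLocalForm L 3 v))) (hn : (n : ↥(unitaryGroupOfForm (conjLocal L (IsCMField.complexConj L) v) (cmLocalForm L 3 v))) ∈ cmLocalIntegralLevel L 3 (Matrix.of fun i j : Fin 3 => if i.val + j.val + 1 = 3 then (1 : L) else 0) v)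
    (h0 : (redMat (((n : ↥(unitaryGroupOfForm (conjLocal L (IsCMField.complexConj L) v) (cmLocalForm L 3 v))) : GL (Fin 3) (LocalRing L v)).val.map (Pi.evalRingHom (fun w' : PlacesOver L v => w'.1.adicCompletion L) w)) - 1).rank = 0) :
    ValBound 1 (((n : ↥(unitaryGroupOfForm (conjLocal L (IsCMField.complexConj L) v) (cmLocalForm L 3 v))) : GL (Fin 3) (LocalRing L v)).val.map (Pi.evalRingHom (fun w' : PlacesOver L v => w'.1.adicCompletion L) w)) ∧ ValBound 1 ((toPlace v w (HeckeCharacter.uniformizer ↥(maximalRealSubfield L) v : v.adicCompletion ↥(maximalRealSubfield L)))⁻¹ • ((((n : ↥(unitaryGroupOfForm (conjLocal L (IsCMField.complexConj L) v) (cmLocalForm L 3 v))) : GL (Fin 3) (LocalRing L v)).val.map (Pi.evalRingHom (fun w' : PlacesOver L v => w'.1.adicCompletion L) w)) - 1)) ∧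
      (redMat ((toPlace v w (HeckeCharacter.uniformizer ↥(maximalRealSubfield L) v : v.adicCompletion ↥(maximalRealSubfield L)))⁻¹ • ((((n : ↥(unitaryGroupOfForm (conjLocal L (IsCMField.complexConj L) v) (cmLocalForm L 3 v))) : GL (Fin 3) (LocalRing L v)).val.map (Pi.evalRingHom (fun w' : PlacesOver L v => w'.1.adicCompletion L) w)) - 1))) ^ 3 = 0 := by
  have hcne := IsCMField.complexConj_ne_one L
  haveI : Algebra.IsQuadraticExtension ↥(maximalRealSubfield L) L := IsCMField.isQuadraticExtension L
  letI : Invertible (2 : LocalRing L v) := (isUnit_two_localRing L v).invertible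
  have hvb : ValBound 1 (((n : ↥(unitaryGroupOfForm (conjLocal L (IsCMField.complexConj L) v) (cmLocalForm L 3 v))) : GL (Fin 3) (LocalRing L v)).val.map (Pi.evalRingHom (fun w' : PlacesOver L v => w'.1.adicCompletion L) w)) := by
    intro i j
    have h := ((mem_glInt_iff _).1 ((mem_localIntegralLevel_iff_of_smul_eq (IsCMField.complexConj L) 3 _ hcne w hw _).1 hn)).1 i j
    rw [coe_coe_localNonsplitEquiv_apply] at h
    exact (Valuation.mem_integer_iff _ _).1 h
  refine ⟨hvb, ?_⟩
  have hn' := HeisRing.heisElt_heisX_heisY (conjLocal L (IsCMField.complexConj L) v) (conjLocal_conjLocal_cm L v) (cmLocalForm_eq_over L 3 v) n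
  rw [← hn'] at hn h0 ⊢
  obtain ⟨hx, hz⟩ := (heisElt_mem_cmLocalIntegralLevel_iff_heisZ L v w hw _ _).1 hn
  obtain ⟨hx', hz'⟩ := (rank_redMat_map_heisElt_sub_one_eq_zero_iff_of_heisZ L v w hw hx hz).1 h0
  exact valBound_inv_smul_map_heisElt_sub_one_of_heisZ L v w hw hunr hx' hz'

end Literature.NumberTheory.Automorphic.UnitaryGroup

end
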